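import Summits.Ventures.QEC.Expanders.QuantumExpanderProp11Projection
import Summits.Ventures.QEC.Expanders.BiregularExpanderExistence
import HarnessLib

/-!
# FGL18 Proposition 11 without the degree-ratio factor: the printed radius as a corollary, the `Z`-sector, and the
# instantiation on the tree's explicit-size expander family (both sectors, unbalanced degrees included) — PROOF

Index of sources: `[cite: FawziGrospellierLeverrier2018]` = Fawzi–Grospellier–Leverrier, STOC 2018 / arXiv:1711.08351v2: Def. 10,
Prop. 11, Remark 9 (§3.2, p0011 L1-24), §2.3 (the `X`- and `Z`-decoding algorithms; p0008 L1-6).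

Venture QEC (`Summits/Ventures/QEC/Expanders`), row 04 (`prover-qec-type-04`, gen 7), item «04.PROJ11», second file (split for the
400-line rule). Everything here instantiates `fgl18_proposition11_proj` of `QuantumExpanderProp11Projection.lean` (every small-set-flip
decoder with `κ ≤ β̃·max Δ` corrects every `X`-error of weight `≤ (β̃/(1+β̃))·min(γ_A n_A, γ_B n_B)`, `β̃ > 0`, `δ ≥ 0`):

* `fgl18_proposition11_minmax_of_proj` — the printed / tree radius `(min Δ/max Δ)(β̃/(1+β̃))·min` (`fgl18_proposition11_minmax_of_le`)
  re-derived as the special case `min Δ/max Δ ≤ 1` (with `δ ≥ 0`);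
* `fgl18_proposition11_proj_zsector` — the `Z`-sector of `Q_G` in its own coordinates (block-swap transport);
* `exists_ssf_radius_family_beta` — on the NAMED family `exists_biregular_expander_fgl18` (every `Δ_A, Δ_B ≥ 9`, balanced or not;
  both sectors; every `κ ≤ β̃·max Δ`), and the unbalanced instance `exists_ssf_radius_family_beta_9_18` (`(Δ_A,Δ_B) = (9,18)`:
  there the printed radius carries the extra factor `min/max = 1/2`) — non-vacuity of the unbalanced gain on the tree's families.

STATUS / HONEST FRAMING: as in the first file — OURS as a statement only for unbalanced degrees and `δ ≥ 0`; equal to print for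
`Δ_A = Δ_B`; existence form for the family (probabilistic method inside `exists_biregular_expander_fgl18`). PROVED (kernel axioms);
no definitions, no named facts.
-/

namespace Summit.Ventures.QEC.Expanders

open Finset Matrix Literature.InformationTheory.QuantumCodes Literature.InformationTheory.QuantumCodes.QuantumExpander

variable {A B : Type*} [Fintype A] [Fintype B] [DecidableEq A] [DecidableEq B]

/-- The printed/tree radius is the special case `r̃ = min Δ/max Δ ≤ 1`: `fgl18_proposition11_minmax_of_le` re-derived from
`fgl18_proposition11_proj` (with `δ ≥ 0`). [cite: FawziGrospellierLeverrier2018, Prop 11 (§3.2, arXiv v2 p0011 L4-24)] -/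
theorem fgl18_proposition11_minmax_of_proj (H : Matrix B A (ZMod 2)) {dA dB : ℕ} {γA δA γB δB : ℝ}
    (hreg : IsBiregular H dA dB) (hexp : IsLeftRightExpanding H dA dB γA δA γB δB)
    (hdA : 0 < dA) (hdB : 0 < dB) (hδA : 0 ≤ δA) (hδB : 0 ≤ δB)
    (hβ : 0 < betaZero (min dA dB) (max dA dB) δA δB)
    {κ : ℝ} (hκ : κ ≤ betaZero (min dA dB) (max dA dB) δA δB * ((max dA dB : ℕ) : ℝ))
    (D : Decoder (A × B → ZMod 2) ((A × A) ⊕ (B × B) → ZMod 2))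
    (hD : IsSSFDecoder κ (expanderHX H) (expanderHZ H) D) (e : (A × A) ⊕ (B × B) → ZMod 2)
    (he : (hammingNorm e : ℝ) ≤
      ((min dA dB : ℕ) : ℝ) / ((max dA dB : ℕ) : ℝ) * betaZero (min dA dB) (max dA dB) δA δB
        / (1 + betaZero (min dA dB) (max dA dB) δA δB) * min (γA * Fintype.card A) (γB * Fintype.card B)) :
    D.Corrects (fun x => expanderHX H *ᵥ x) (rowSpace (expanderHZ H) : Set _) e := by
  refine fgl18_proposition11_proj H hreg hexp hdA hdB hδA hδB hβ hκ D hD e ?_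
  set β : ℝ := betaZero (min dA dB) (max dA dB) δA δB with hβdef
  set M := min (γA * Fintype.card A) (γB * Fintype.card B) with hM
  have hM' : (0 : ℝ) < ((max dA dB : ℕ) : ℝ) := by exact_mod_cast lt_max_of_lt_left hdA
  have hm' : (0 : ℝ) < ((min dA dB : ℕ) : ℝ) := by exact_mod_cast lt_min hdA hdB
  have hr1 : ((min dA dB : ℕ) : ℝ) / ((max dA dB : ℕ) : ℝ) ≤ 1 := by
    rw [div_le_one hM']
    exact_mod_cast min_le_max
  have hr0 : (0 : ℝ) < ((min dA dB : ℕ) : ℝ) / ((max dA dB : ℕ) : ℝ) := div_pos hm' hM'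
  have hb : 0 < β / (1 + β) := div_pos hβ (by linarith)
  have h0 : (0 : ℝ) ≤ hammingNorm e := Nat.cast_nonneg _
  have hrew : ((min dA dB : ℕ) : ℝ) / ((max dA dB : ℕ) : ℝ) * β / (1 + β) * M
      = ((min dA dB : ℕ) : ℝ) / ((max dA dB : ℕ) : ℝ) * (β / (1 + β) * M) := by ring
  rcases le_or_gt 0 M with hM0 | hM0
  · rw [hrew] at he
    calc (hammingNorm e : ℝ) ≤ ((min dA dB : ℕ) : ℝ) / ((max dA dB : ℕ) : ℝ) * (β / (1 + β) * M) := he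
      _ ≤ 1 * (β / (1 + β) * M) := mul_le_mul_of_nonneg_right hr1 (mul_nonneg hb.le hM0)
      _ = β / (1 + β) * M := one_mul _
  · exfalso
    have hneg : ((min dA dB : ℕ) : ℝ) / ((max dA dB : ℕ) : ℝ) * (β / (1 + β) * M) < 0 :=
      mul_neg_of_pos_of_neg hr0 (mul_neg_of_pos_of_neg hb hM0)
    rw [hrew] at he
    linarith

/-- **`Z`-sector of `Q_G` in its own coordinates**: every small-set-flip decoder `D_Z` (syndromes `expanderHZ H`, generators
`expanderHX H`) with `κ ≤ β̃·max Δ` corrects every `Z`-error of weight `≤ (β̃/(1+β̃))·min(γ_A n_A, γ_B n_B)` (the reversed-graph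
statement transported along the block swap; `β̃` is symmetric in `(δ_A, δ_B)` by `betaZero_symm_delta`). STATUS: OURS for
unbalanced degrees. [cite: FawziGrospellierLeverrier2018, Prop 11 with §2.3 ("an X-decoding algorithm … and a Z-decoding algorithm"; arXiv v2 p0008 L1-6)] -/
theorem fgl18_proposition11_proj_zsector (H : Matrix B A (ZMod 2)) {dA dB : ℕ} {γA δA γB δB : ℝ}
    (hreg : IsBiregular H dA dB) (hexp : IsLeftRightExpanding H dA dB γA δA γB δB)
    (hdA : 0 < dA) (hdB : 0 < dB) (hδA : 0 ≤ δA) (hδB : 0 ≤ δB)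
    (hβ : 0 < betaZero (min dA dB) (max dA dB) δA δB)
    {κ : ℝ} (hκ : κ ≤ betaZero (min dA dB) (max dA dB) δA δB * ((max dA dB : ℕ) : ℝ))
    (D : Decoder (B × A → ZMod 2) ((A × A) ⊕ (B × B) → ZMod 2))
    (hD : IsSSFDecoder κ (expanderHZ H) (expanderHX H) D) (e : (A × A) ⊕ (B × B) → ZMod 2)
    (he : (hammingNorm e : ℝ) ≤
      betaZero (min dA dB) (max dA dB) δA δB / (1 + betaZero (min dA dB) (max dA dB) δA δB)
        * min (γA * Fintype.card A) (γB * Fintype.card B)) :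
    D.Corrects (fun x => expanderHZ H *ᵥ x)
      (rowSpace (expanderHX H) : Set ((A × A) ⊕ (B × B) → ZMod 2)) e := by
  set σ := Equiv.sumComm (A × A) (B × B) with hσ
  rw [expanderHZ_eq_submatrix_swap H, expanderHX_eq_submatrix_swap H] at hD ⊢
  have hD' := isSSFDecoder_comp_equiv σ hD
  have hregT : IsBiregular Hᵀ dB dA := isBiregular_transpose H hreg
  have hexpT : IsLeftRightExpanding Hᵀ dB dA γB δB γA δA := by
    refine ⟨(isLeftExpanding_transpose_iff H dB γB δB).2 hexp.2, ?_⟩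
    have h : IsLeftExpanding Hᵀᵀ dA γA δA := by rw [Matrix.transpose_transpose]; exact hexp.1
    exact (isLeftExpanding_transpose_iff Hᵀ dA γA δA).1 h
  have hβT : 0 < betaZero (min dB dA) (max dB dA) δB δA := by
    rw [min_comm, max_comm, betaZero_symm_delta]; exact hβ
  have hκT : κ ≤ betaZero (min dB dA) (max dB dA) δB δA * ((max dB dA : ℕ) : ℝ) := by
    rw [min_comm, max_comm, betaZero_symm_delta]; exact hκ
  have he' : (hammingNorm (e ∘ σ.symm) : ℝ) ≤
      betaZero (min dB dA) (max dB dA) δB δA / (1 + betaZero (min dB dA) (max dB dA) δB δA)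
        * min (γB * Fintype.card B) (γA * Fintype.card A) := by
    rw [hammingNorm_comp_equiv e σ, min_comm (γB * _), min_comm dB, max_comm dB, betaZero_symm_delta]; exact he
  have h := fgl18_proposition11_proj Hᵀ hregT hexpT hdB hdA hδB hδA hβT hκT _ hD' (e ∘ σ.symm) he'
  exact (corrects_comp_equiv_iff σ D e).1 h

/-! ### Instantiation on the tree's expander family (non-vacuity, both sectors, unbalanced degrees included) -/

/-- **The radius `(β̃/(1+β̃))·min(γ n_A, γ n_B)` on an explicit-size family, both sectors, every `κ ≤ β̃·max Δ`**: for ALL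
`Δ_A, Δ_B ≥ 9` (balanced or not) there are `γ, δ > 0` with `β̃ = betaZero (min Δ) (max Δ) δ δ > 0` and, for every `n`, a
`(Δ_A,Δ_B)`-biregular `(γ,δ,γ,δ)`-expander `H_n` (the named family `exists_biregular_expander_fgl18`, random lifts) such that
every small-set-flip decoder with threshold `κ ≤ β̃·max(Δ_A,Δ_B)` of EITHER sector of `Q_{H_n}` corrects every error `e` of
its type with `|e| ≤ (β̃/(1+β̃))·min(γ·|Fin Δ_B × Fin n|, γ·|Fin Δ_A × Fin n|)`. For `Δ_A ≠ Δ_B` this radius is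
`max Δ/min Δ` times the one the printed Prop. 11 gives for the same family. STATUS: OURS for unbalanced degrees; existence
form. [cite: FawziGrospellierLeverrier2018, Prop 11 (§3.2, arXiv v2 p0011) with Thm 1's remark on random biregular graphs] -/
theorem exists_ssf_radius_family_beta (dA dB : ℕ) (hA : 9 ≤ dA) (hB : 9 ≤ dB) :
    ∃ (γ δ : ℝ), 0 < γ ∧ 0 < δ ∧ 0 < betaZero (min dA dB) (max dA dB) δ δ ∧
      ∀ n : ℕ, ∃ H : Matrix (Fin dA × Fin n) (Fin dB × Fin n) (ZMod 2),
        IsBiregular H dA dB ∧ IsLeftRightExpanding H dA dB γ δ γ δ ∧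
        (∀ κ : ℝ, κ ≤ betaZero (min dA dB) (max dA dB) δ δ * ((max dA dB : ℕ) : ℝ) →
          ∀ D : Decoder ((Fin dB × Fin n) × (Fin dA × Fin n) → ZMod 2)
            (((Fin dB × Fin n) × (Fin dB × Fin n)) ⊕ ((Fin dA × Fin n) × (Fin dA × Fin n)) → ZMod 2),
          IsSSFDecoder κ (expanderHX H) (expanderHZ H) D →
          ∀ e : ((Fin dB × Fin n) × (Fin dB × Fin n)) ⊕ ((Fin dA × Fin n) × (Fin dA × Fin n)) → ZMod 2,
            (hammingNorm e : ℝ) ≤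
                betaZero (min dA dB) (max dA dB) δ δ / (1 + betaZero (min dA dB) (max dA dB) δ δ) *
                  min (γ * Fintype.card (Fin dB × Fin n)) (γ * Fintype.card (Fin dA × Fin n)) →
            D.Corrects (fun x => expanderHX H *ᵥ x) (rowSpace (expanderHZ H) : Set _) e) ∧
        (∀ κ : ℝ, κ ≤ betaZero (min dA dB) (max dA dB) δ δ * ((max dA dB : ℕ) : ℝ) →
          ∀ D : Decoder ((Fin dA × Fin n) × (Fin dB × Fin n) → ZMod 2)
            (((Fin dB × Fin n) × (Fin dB × Fin n)) ⊕ ((Fin dA × Fin n) × (Fin dA × Fin n)) → ZMod 2),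
          IsSSFDecoder κ (expanderHZ H) (expanderHX H) D →
          ∀ e : ((Fin dB × Fin n) × (Fin dB × Fin n)) ⊕ ((Fin dA × Fin n) × (Fin dA × Fin n)) → ZMod 2,
            (hammingNorm e : ℝ) ≤
                betaZero (min dA dB) (max dA dB) δ δ / (1 + betaZero (min dA dB) (max dA dB) δ δ) *
                  min (γ * Fintype.card (Fin dB × Fin n)) (γ * Fintype.card (Fin dA × Fin n)) →
            D.Corrects (fun x => expanderHZ H *ᵥ x) (rowSpace (expanderHX H) : Set _) e) := by
  obtain ⟨γ, δ, hγ, hδ, hβ0, hfam⟩ := exists_biregular_expander_fgl18 dA dB hA hB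
  have hdA : 0 < dA := by omega
  have hdB : 0 < dB := by omega
  have hβ : 0 < betaZero (min dA dB) (max dA dB) δ δ := by
    have hc := (betaZero_pos_iff hdA hdB δ δ).1 hβ0
    exact (betaZero_pos_iff (lt_min hdA hdB) (lt_max_of_lt_left hdA) δ δ).2 hc
  refine ⟨γ, δ, hγ, hδ, hβ, fun n => ?_⟩
  obtain ⟨H, hreg, hexp⟩ := hfam n
  exact ⟨H, hreg, hexp,
    fun κ hκ D hD e he => fgl18_proposition11_proj H hreg hexp hdA hdB hδ.le hδ.le hβ hκ D hD e he,
    fun κ hκ D hD e he => fgl18_proposition11_proj_zsector H hreg hexp hdA hdB hδ.le hδ.le hβ hκ D hD e he⟩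

/-- **An UNBALANCED instance: `(Δ_A, Δ_B) = (9, 18)`** — a named tree family on which the new radius is twice the printed one
(`min Δ/max Δ = 1/2`), in both sectors and for every threshold `κ ≤ 18β̃` (Algorithm 1 included). STATUS: OURS; shows the
unbalanced gain is not vacuous on the tree's families. [cite: FawziGrospellierLeverrier2018, Prop 11 (§3.2, arXiv v2 p0011)] -/
theorem exists_ssf_radius_family_beta_9_18 :
    ∃ (γ δ : ℝ), 0 < γ ∧ 0 < δ ∧ 0 < betaZero (min 9 18) (max 9 18) δ δ ∧
      ∀ n : ℕ, ∃ H : Matrix (Fin 9 × Fin n) (Fin 18 × Fin n) (ZMod 2),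
        IsBiregular H 9 18 ∧ IsLeftRightExpanding H 9 18 γ δ γ δ ∧
        (∀ κ : ℝ, κ ≤ betaZero (min 9 18) (max 9 18) δ δ * ((max 9 18 : ℕ) : ℝ) →
          ∀ D : Decoder ((Fin 18 × Fin n) × (Fin 9 × Fin n) → ZMod 2)
            (((Fin 18 × Fin n) × (Fin 18 × Fin n)) ⊕ ((Fin 9 × Fin n) × (Fin 9 × Fin n)) → ZMod 2),
          IsSSFDecoder κ (expanderHX H) (expanderHZ H) D →
          ∀ e : ((Fin 18 × Fin n) × (Fin 18 × Fin n)) ⊕ ((Fin 9 × Fin n) × (Fin 9 × Fin n)) → ZMod 2,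
            (hammingNorm e : ℝ) ≤
                betaZero (min 9 18) (max 9 18) δ δ / (1 + betaZero (min 9 18) (max 9 18) δ δ) *
                  min (γ * Fintype.card (Fin 18 × Fin n)) (γ * Fintype.card (Fin 9 × Fin n)) →
            D.Corrects (fun x => expanderHX H *ᵥ x) (rowSpace (expanderHZ H) : Set _) e) ∧
        (∀ κ : ℝ, κ ≤ betaZero (min 9 18) (max 9 18) δ δ * ((max 9 18 : ℕ) : ℝ) →
          ∀ D : Decoder ((Fin 9 × Fin n) × (Fin 18 × Fin n) → ZMod 2)
            (((Fin 18 × Fin n) × (Fin 18 × Fin n)) ⊕ ((Fin 9 × Fin n) × (Fin 9 × Fin n)) → ZMod 2),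
          IsSSFDecoder κ (expanderHZ H) (expanderHX H) D →
          ∀ e : ((Fin 18 × Fin n) × (Fin 18 × Fin n)) ⊕ ((Fin 9 × Fin n) × (Fin 9 × Fin n)) → ZMod 2,
            (hammingNorm e : ℝ) ≤
                betaZero (min 9 18) (max 9 18) δ δ / (1 + betaZero (min 9 18) (max 9 18) δ δ) *
                  min (γ * Fintype.card (Fin 18 × Fin n)) (γ * Fintype.card (Fin 9 × Fin n)) →
            D.Corrects (fun x => expanderHZ H *ᵥ x) (rowSpace (expanderHX H) : Set _) e) :=
  exists_ssf_radius_family_beta 9 18 (by norm_num) (by norm_num)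

end Summit.Ventures.QEC.Expanders
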